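import Summits.NavierStokesRegularity.NavierStokesRegularity.Theses.CoriolisHead
import Literature.Analysis.FluidPDE.PineauVicolRSSHolds
import HarnessLib

/-!
# Route CoriolisHead · crux `NoCoRotatingCore` (stmt-NavierStokesRegularity-22676) —
# RUNG BY NAME: no co-rotating core for Type-I rotated self-similar profiles at extreme rotation rates

Support file (`--supports stmt-NavierStokesRegularity-22676`; theorems only, no definitions, no named
facts): the DECIDED REGIME IN PRINT of the crux's statement family, cited BY NAME from the tree.

THE REGIME.  Pineau–Vicol 2026, Theorem 1.4 (tree: the named fact
`Literature.Analysis.FluidPDE.pineauVicol2026_rss_liouville`, DISCHARGED in tree as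
`pineauVicol2026_rss_liouville_holds`): for every Type-I constant `C₀ > 0` there are `α₁(C₀) > 0` and
`α₂(C₀) > 0` such that a classical Navier–Stokes solution on `[−1,0) × ℝ³` (`ν = 1`) with the Type-I
bound `|u(t,x)| ≤ C₀/(|x| + √(−t))`, which is backwards ROTATED SELF-SIMILAR with angular speed `α`
and profile `U ∈ C²` (`u = pvAnsatz α U`, rotation `rotZ` about `e₃`), has `U ≡ 0` whenever
`|α| < α₁` or `|α| > α₂`.

THE RUNG (`noCoRotatingCore_of_pvAnsatz_extreme_rotation`): the binders of `CoriolisHead.NoCoRotatingCore`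
verbatim (any `ν, a > 0`, any skew `B`, the rotated profile system, boundedness) PLUS the regime
hypotheses above on `U` ⟹ the crux's conclusion `0 ≤ Σₗ (B ∂ₗU(y))ₗ` at every point — because
`U ≡ 0`, so `DU ≡ 0` (`fderiv_eq_zero_of_pvAnsatz_extreme_rotation`).  Of the crux's own hypotheses
only `U ∈ C^∞` is used; the frame `B` of the binder is not tied to `α` (for the genuine profile of the
ansatz it is the `e₃`-rotation at rate `∓α` in the normalisation `ν = 1`, `a = ½`, cf. the route's
proved support `SolitonToProfile`), which only widens the statement.

HONEST FRAMING.  A witness BY NAME (the analogue, for the deciding crux, of the `B = 0` Tsai witness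
the tribunal recorded for `CounterRotatingLiouville`): it imports a theorem in print and decides the
crux only where Pineau–Vicol already decide the whole rotated Liouville problem (decaying profiles,
`|α| ≪ 1` or `≫ 1`).  The crux `NoCoRotatingCore` — bounded profiles, EVERY rotation rate, in
particular `α ≈ 1` (Pineau–Vicol's open case) — and Navier–Stokes regularity are NOT proved.
Companion rungs with mechanism: `CoriolisHeadNoCoRotatingCoreNoAxialVelocity` (zero strain feed,
energy Liouville), `…Axisymmetric`, `…Helical`.

References: B. Pineau, V. Vicol, arXiv:2607.09619, Theorem 1.4, Conjecture 1.1, (1.7)–(1.10)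
[PineauVicol2026]; D. Chae, J. Wolf, ARMA 225 (2017) (the case α = 0) [ChaeWolf2017RemovingDSS].
-/

noncomputable section

-- the summit and its single sub-problem share the name (CONVENTIONS §1), as in every Theorems file
set_option linter.dupNamespace false

open Set
open scoped RealInnerProductSpace Laplacian ContDiff BigOperators
open Literature.Analysis.FluidPDE

namespace Summit.NavierStokesRegularity.NavierStokesRegularity.Theorems.CoriolisHead

/-- **Type-I rotated self-similar profiles at extreme rotation rates have zero gradient** (they
vanish): Pineau–Vicol 2026 Thm 1.4 from the tree, read on the velocity gradient.
[cite: PineauVicol2026, Theorem 1.4 (arXiv:2607.09619 p. 4)] -/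
theorem fderiv_eq_zero_of_pvAnsatz_extreme_rotation (C₀ : ℝ) (hC₀ : 0 < C₀) :
    ∃ α₁ α₂ : ℝ, 0 < α₁ ∧ 0 < α₂ ∧
      ∀ (α : ℝ) (u : ℝ → EuclideanSpace ℝ (Fin 3) → EuclideanSpace ℝ (Fin 3))
        (p : ℝ → EuclideanSpace ℝ (Fin 3) → ℝ) (U : EuclideanSpace ℝ (Fin 3) → EuclideanSpace ℝ (Fin 3)),
        ContDiff ℝ (⊤ : ℕ∞) U →
        IsClassicalNSSolutionOn (Ico (-1) 0) 1 0 u p →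
        (∀ t ∈ Ico (-1 : ℝ) 0, ∀ x : EuclideanSpace ℝ (Fin 3), ‖u t x‖ ≤ C₀ / (‖x‖ + Real.sqrt (-t))) →
        (∀ t ∈ Ico (-1 : ℝ) 0, ∀ x : EuclideanSpace ℝ (Fin 3), u t x = pvAnsatz α (fun y _ => U y) t x) →
        (|α| < α₁ ∨ α₂ < |α|) →
        ∀ y, fderiv ℝ U y = 0 := by
  obtain ⟨α₁, α₂, hα₁, hα₂, h⟩ := pineauVicol2026_rss_liouville_holds C₀ hC₀
  refine ⟨α₁, α₂, hα₁, hα₂, fun α u p U hU hns hTI hans hα y => ?_⟩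
  have hU0 : U = 0 := h α u p U hns hTI (hU.of_le (by norm_cast)) hans hα
  rw [hU0]
  exact fderiv_const_apply _

/-- **RUNG BY NAME of `NoCoRotatingCore` (bc5 witness): no co-rotating core for Type-I rotated
self-similar profiles at extreme rotation rates.**  For every Type-I constant `C₀ > 0` there are
`α₁, α₂ > 0` (Pineau–Vicol) such that: the binders of `CoriolisHead.NoCoRotatingCore` — any `ν, a > 0`,
skew `B`, a smooth bounded divergence-free solution `(U, P)` of the rotated Leray profile system — plus
"`U` is the profile of a backwards rotated self-similar classical Navier–Stokes solution on `[−1,0)`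
with Type-I bound `C₀` and angular speed `|α| < α₁` or `|α| > α₂`" imply the crux's conclusion
`0 ≤ Σₗ (B ∂ₗU(y))ₗ` at every point (`U ≡ 0` there).  The crux at `α ≈ 1` and for merely bounded
profiles remains open. [cite: PineauVicol2026, Theorem 1.4 (arXiv:2607.09619 p. 4)] -/
theorem noCoRotatingCore_of_pvAnsatz_extreme_rotation (C₀ : ℝ) (hC₀ : 0 < C₀) :
    ∃ α₁ α₂ : ℝ, 0 < α₁ ∧ 0 < α₂ ∧
      ∀ (α : ℝ) (u : ℝ → EuclideanSpace ℝ (Fin 3) → EuclideanSpace ℝ (Fin 3))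
        (p : ℝ → EuclideanSpace ℝ (Fin 3) → ℝ),
      ∀ (ν a : ℝ), 0 < ν → 0 < a →
      ∀ (B : EuclideanSpace ℝ (Fin 3) →L[ℝ] EuclideanSpace ℝ (Fin 3))
        (U : EuclideanSpace ℝ (Fin 3) → EuclideanSpace ℝ (Fin 3)) (P : EuclideanSpace ℝ (Fin 3) → ℝ),
        ContDiff ℝ (⊤ : ℕ∞) U → ContDiff ℝ 2 P → (∀ x, inner ℝ (B x) x = 0) →
        Literature.Analysis.FluidPDE.VectorCalculus.IsDivFree U →
        (∀ y, -(ν • Laplacian.laplacian U y) + a • U y + a • fderiv ℝ U y y + (B (U y) - fderiv ℝ U y (B y))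
          + Literature.Analysis.FluidPDE.convect U U y + gradient P y = 0) →
        (∃ M : ℝ, ∀ y, ‖U y‖ ≤ M) →
        IsClassicalNSSolutionOn (Ico (-1) 0) 1 0 u p →
        (∀ t ∈ Ico (-1 : ℝ) 0, ∀ x : EuclideanSpace ℝ (Fin 3), ‖u t x‖ ≤ C₀ / (‖x‖ + Real.sqrt (-t))) →
        (∀ t ∈ Ico (-1 : ℝ) 0, ∀ x : EuclideanSpace ℝ (Fin 3), u t x = pvAnsatz α (fun y _ => U y) t x) →
        (|α| < α₁ ∨ α₂ < |α|) →
        ∀ y, 0 ≤ ∑ l, (B (fderiv ℝ U y (EuclideanSpace.single l 1))) l := by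
  obtain ⟨α₁, α₂, hα₁, hα₂, h⟩ := fderiv_eq_zero_of_pvAnsatz_extreme_rotation C₀ hC₀
  refine ⟨α₁, α₂, hα₁, hα₂, ?_⟩
  intro α u p ν a _hν _ha B U P hU _hP _hB _hdiv _heq _hbdd hns hTI hans hα y
  simp [h α u p U hU hns hTI hans hα y]

end Summit.NavierStokesRegularity.NavierStokesRegularity.Theorems.CoriolisHead

end
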